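import Summits.QuantumFields.YangMills.Theorems.UnitScaleTiltProp7SectET3BgClass
import HarnessLib

/-!
# Route `UnitScaleTilt` (α), node N06(d = 3) — **THE ALGEBRA OF THE DISPLAYED `norm_G` ∕ `norm_H₁` ∕ `norm_H` ROW SHAPE**: the conclusion telescope of ✓ `normG_row_of_recordObligations`,
# ✓ `normG_row_of_evaluationRows(S)`, ✓ `normH₁_row_of_evaluationRows(S)` … (`∃ M₄ a₀ B₀′ > 0, ∀ member …, M₄ ≤ L·L^{a'} → ∀ e U₀, RegPr … e U₀ → e ≤ a₀∕(L·L^{a'}) → ∀ f,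
# ‖Gop (memberIdx …) (cfgV1OfT3 U₀) f‖ ≤ B₀′‖f‖`) is CLOSED UNDER finite sums of the operator family, pointwise domination with a constant, and contains `0` — so a normed letter
# read DIRECTION BY DIRECTION through scalar sources (design point (J2) of seat ym-inputs-p05, bus 2026-08-28 ≈09:50Z) inherits the row from its per-direction pieces

Cell `ym-inputs` (D-0154 (2); desk `ym-inputs-plan-1` INPUT-LIST v7 §4 row p05 = I-06 (d) ∕ brick L0f), seat ym-inputs-p05.  Count-neutral helper (`--supports stmt-QuantumFields-20520
--as helper`; RULING g26-№2); registry untouched; THEOREMS ONLY (0 `def`, 0 `sorry`); NOTHING of [Balaban1985BackgroundPropagators] ∕ [Balaban1985Variational] is asserted.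

THE POINT (J2, located).  The T³ leaves read the kernel-family entries through SCALAR sources `(geo9K i).Loc = Node00.KLoc i` (Track A's U = 1 census is diagonal in the Lie index), while
the route's letters `𝒢f`∕`H₁f`∕`H` act on M₂(ℂ)-valued fields.  In the reduced consumers (✓ `…NormGReduced(S)`, ✓ `…NormH1Reduced`) NO analytic row mentions the evaluation maps
`ev`∕`evY` — only the ten evaluation rows and the readout do — so the consumer can be applied ONCE PER REAL COORDINATE DIRECTION κ of the fibre (`ev_κ` = «place the scalar source in
direction κ», `Gop_κ f := c⁻¹•𝒢f(π_κ f)`), with the SAME analytic rows every time; the per-direction rows then ADD UP to the row for `𝒢f = Σ_κ 𝒢f ∘ π_κ` with `M₄ := max`, `a₀ := min`,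
`B₀′ := Σ` — this file's ★ `normRow_add` ∕ ★★ `normRow_sum` (over `Fin k`), closed by ★ `normRow_of_le` (pointwise domination `‖G f‖ ≤ c‖G′ f‖`, e.g. the fibre-norm∕component constant
and `𝒢f f = Σ_κ 𝒢f(π_κ f)`) and `normRow_zero`.  ONE shape serves `norm_G`, `norm_H₁` and `norm_H` (the telescope is the same with `f` ∕ `b`).
HONEST SCOPE: bookkeeping (`norm_add_le`, `max`∕`min`, induction on `Fin k`); no estimate; N06(d = 3) NOT discharged; nothing here claims EX, the crux, V3∕R3, d = 4 or the mass gap;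
YM₃ on T³ is ladder rung R3, not the Clay problem.

References: T. Bałaban, CMP **102** (1985) 277–309 [Balaban1985Variational] ((103) p.293, (115) p.294, (117) p.295); CMP **99** (1985) 389–434 [Balaban1985BackgroundPropagators]
(Thm 3.12 p.423, Thm 3.13 p.426); CMP **99** (1985) 75–102 [Balaban1985RegularSpaces] ((1.33) p.82).
-/

set_option autoImplicit false

noncomputable section

open scoped Matrix.Norms.L2Operator

namespace Summit.QuantumFields.YangMills.Theorems.Prop7SectET3NormRowAlgebra

open Literature.MathematicalPhysics.QuantumFieldTheory.Balaban1983to89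
open Literature.MathematicalPhysics.QuantumFieldTheory.Balaban1983to89.T3ContinuumYM3Torus
open Literature.MathematicalPhysics.QuantumFieldTheory.Balaban1983to89.T3PrintedRegularMinimiser (RegPr)
open Literature.MathematicalPhysics.QuantumFieldTheory.Balaban1983to89.B6KLevelCensusIndexV1 (KIdx)
open Literature.MathematicalPhysics.QuantumFieldTheory.Balaban1983to89.B6GlobalChartV1 (PV)
open Summit.QuantumFields.YangMills.Theorems.Prop7SectET3Members (hd3 memberIdx)
open Summit.QuantumFields.YangMills.Theorems.Prop7SectET3BgClass (bgT3 cfgV1OfT3)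

variable {ℓ : ℕ} {hL : Odd (ℓ + 1) ∧ 1 < ℓ + 1}
variable {Xo Yo : ∀ i : KIdx 2 ℓ hd3 hL 1 1, (bgT3 i).Cfg → Type} [∀ i U, SeminormedAddCommGroup (Xo i U)] [∀ i U, SeminormedAddCommGroup (Yo i U)]

/-- The member's big-block size `L·L^{a'}` is positive. [folklore] -/
theorem bigBlock_pos (a' : ℕ) : 0 < ((ℓ + 1 : ℕ) : ℝ) * (((ℓ + 1) ^ a' : ℕ) : ℝ) := by positivity

/-- `normRow_zero` — **THE ZERO FAMILY HAS THE ROW** (constants `1, 1, 1`). [cite: Balaban1985Variational, (117) p.295 (shape only; bookkeeping)] -/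
theorem normRow_zero :
    ∃ M₄ a₀ B₀' : ℝ, 0 < M₄ ∧ 0 < a₀ ∧ 0 < B₀' ∧
      ∀ (hℓ : 4 ≤ ℓ) (m : ℕ) (hm : 1 ≤ m) (n K a' R : ℕ) (hk1 : 1 ≤ K - n) (hsize : a' + 3 ≤ m + n) (hM8 : 8 ≤ (ℓ + 1) ^ a') (hR2 : 2 * (ℓ + 1) ^ 2 ≤ R),
        M₄ ≤ ((ℓ + 1 : ℕ) : ℝ) * (((ℓ + 1) ^ a' : ℕ) : ℝ) →
        ∀ (e : ℝ) (U₀ : GaugeField (PV 2 ℓ m K hd3 hL) 0 (Matrix.specialUnitaryGroup (Fin 2) ℂ)),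
          RegPr (⟨ℓ + 1, hL, m, hm⟩ : T3Family) n K e U₀ → e ≤ a₀ / (((ℓ + 1 : ℕ) : ℝ) * (((ℓ + 1) ^ a' : ℕ) : ℝ)) →
            ∀ f : Xo (memberIdx ℓ hL hℓ m hm n K a' R hk1 hsize hM8 hR2) (cfgV1OfT3 U₀),
              ‖(fun (i : KIdx 2 ℓ hd3 hL 1 1) (U : (bgT3 i).Cfg) (_ : Xo i U) => (0 : Yo i U)) (memberIdx ℓ hL hℓ m hm n K a' R hk1 hsize hM8 hR2) (cfgV1OfT3 U₀) f‖ ≤ B₀' * ‖f‖ := by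
  refine ⟨1, 1, 1, one_pos, one_pos, one_pos, ?_⟩
  intro hℓ m hm n K a' R hk1 hsize hM8 hR2 _ e U₀ _ _ f
  rw [norm_zero, one_mul]
  exact norm_nonneg f

/-- ★ `normRow_add` — **THE ROW IS CLOSED UNDER SUMS OF TWO FAMILIES** (`M₄ := max`, `a₀ := min`, `B₀′ := B₁ + B₂`; `‖G₁ f + G₂ f‖ ≤ ‖G₁ f‖ + ‖G₂ f‖`).
[cite: Balaban1985Variational, (117) p.295 (shape only; bookkeeping)] -/
theorem normRow_add (G₁ G₂ : ∀ (i : KIdx 2 ℓ hd3 hL 1 1) (U : (bgT3 i).Cfg), Xo i U → Yo i U)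
    (h₁ : ∃ M₄ a₀ B₀' : ℝ, 0 < M₄ ∧ 0 < a₀ ∧ 0 < B₀' ∧
      ∀ (hℓ : 4 ≤ ℓ) (m : ℕ) (hm : 1 ≤ m) (n K a' R : ℕ) (hk1 : 1 ≤ K - n) (hsize : a' + 3 ≤ m + n) (hM8 : 8 ≤ (ℓ + 1) ^ a') (hR2 : 2 * (ℓ + 1) ^ 2 ≤ R),
        M₄ ≤ ((ℓ + 1 : ℕ) : ℝ) * (((ℓ + 1) ^ a' : ℕ) : ℝ) →
        ∀ (e : ℝ) (U₀ : GaugeField (PV 2 ℓ m K hd3 hL) 0 (Matrix.specialUnitaryGroup (Fin 2) ℂ)),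
          RegPr (⟨ℓ + 1, hL, m, hm⟩ : T3Family) n K e U₀ → e ≤ a₀ / (((ℓ + 1 : ℕ) : ℝ) * (((ℓ + 1) ^ a' : ℕ) : ℝ)) →
            ∀ f : Xo (memberIdx ℓ hL hℓ m hm n K a' R hk1 hsize hM8 hR2) (cfgV1OfT3 U₀),
              ‖G₁ (memberIdx ℓ hL hℓ m hm n K a' R hk1 hsize hM8 hR2) (cfgV1OfT3 U₀) f‖ ≤ B₀' * ‖f‖)
    (h₂ : ∃ M₄ a₀ B₀' : ℝ, 0 < M₄ ∧ 0 < a₀ ∧ 0 < B₀' ∧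
      ∀ (hℓ : 4 ≤ ℓ) (m : ℕ) (hm : 1 ≤ m) (n K a' R : ℕ) (hk1 : 1 ≤ K - n) (hsize : a' + 3 ≤ m + n) (hM8 : 8 ≤ (ℓ + 1) ^ a') (hR2 : 2 * (ℓ + 1) ^ 2 ≤ R),
        M₄ ≤ ((ℓ + 1 : ℕ) : ℝ) * (((ℓ + 1) ^ a' : ℕ) : ℝ) →
        ∀ (e : ℝ) (U₀ : GaugeField (PV 2 ℓ m K hd3 hL) 0 (Matrix.specialUnitaryGroup (Fin 2) ℂ)),
          RegPr (⟨ℓ + 1, hL, m, hm⟩ : T3Family) n K e U₀ → e ≤ a₀ / (((ℓ + 1 : ℕ) : ℝ) * (((ℓ + 1) ^ a' : ℕ) : ℝ)) →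
            ∀ f : Xo (memberIdx ℓ hL hℓ m hm n K a' R hk1 hsize hM8 hR2) (cfgV1OfT3 U₀),
              ‖G₂ (memberIdx ℓ hL hℓ m hm n K a' R hk1 hsize hM8 hR2) (cfgV1OfT3 U₀) f‖ ≤ B₀' * ‖f‖) :
    ∃ M₄ a₀ B₀' : ℝ, 0 < M₄ ∧ 0 < a₀ ∧ 0 < B₀' ∧
      ∀ (hℓ : 4 ≤ ℓ) (m : ℕ) (hm : 1 ≤ m) (n K a' R : ℕ) (hk1 : 1 ≤ K - n) (hsize : a' + 3 ≤ m + n) (hM8 : 8 ≤ (ℓ + 1) ^ a') (hR2 : 2 * (ℓ + 1) ^ 2 ≤ R),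
        M₄ ≤ ((ℓ + 1 : ℕ) : ℝ) * (((ℓ + 1) ^ a' : ℕ) : ℝ) →
        ∀ (e : ℝ) (U₀ : GaugeField (PV 2 ℓ m K hd3 hL) 0 (Matrix.specialUnitaryGroup (Fin 2) ℂ)),
          RegPr (⟨ℓ + 1, hL, m, hm⟩ : T3Family) n K e U₀ → e ≤ a₀ / (((ℓ + 1 : ℕ) : ℝ) * (((ℓ + 1) ^ a' : ℕ) : ℝ)) →
            ∀ f : Xo (memberIdx ℓ hL hℓ m hm n K a' R hk1 hsize hM8 hR2) (cfgV1OfT3 U₀),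
              ‖(fun (i : KIdx 2 ℓ hd3 hL 1 1) (U : (bgT3 i).Cfg) (f : Xo i U) => G₁ i U f + G₂ i U f) (memberIdx ℓ hL hℓ m hm n K a' R hk1 hsize hM8 hR2) (cfgV1OfT3 U₀) f‖ ≤ B₀' * ‖f‖ := by
  obtain ⟨M₁, A₁, B₁, hM₁, hA₁, hB₁, h₁⟩ := h₁
  obtain ⟨M₂, A₂, B₂, hM₂, hA₂, hB₂, h₂⟩ := h₂
  refine ⟨max M₁ M₂, min A₁ A₂, B₁ + B₂, lt_max_of_lt_left hM₁, lt_min hA₁ hA₂, add_pos hB₁ hB₂, ?_⟩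
  intro hℓ m hm n K a' R hk1 hsize hM8 hR2 hM e U₀ hreg he f
  have hT := bigBlock_pos (ℓ := ℓ) a'
  have he₁ : e ≤ A₁ / (((ℓ + 1 : ℕ) : ℝ) * (((ℓ + 1) ^ a' : ℕ) : ℝ)) := he.trans (div_le_div_of_nonneg_right (min_le_left _ _) hT.le)
  have he₂ : e ≤ A₂ / (((ℓ + 1 : ℕ) : ℝ) * (((ℓ + 1) ^ a' : ℕ) : ℝ)) := he.trans (div_le_div_of_nonneg_right (min_le_right _ _) hT.le)
  calc ‖G₁ _ _ f + G₂ _ _ f‖ ≤ ‖G₁ _ _ f‖ + ‖G₂ _ _ f‖ := norm_add_le _ _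
    _ ≤ B₁ * ‖f‖ + B₂ * ‖f‖ := add_le_add (h₁ hℓ m hm n K a' R hk1 hsize hM8 hR2 ((le_max_left _ _).trans hM) e U₀ hreg he₁ f)
        (h₂ hℓ m hm n K a' R hk1 hsize hM8 hR2 ((le_max_right _ _).trans hM) e U₀ hreg he₂ f)
    _ = (B₁ + B₂) * ‖f‖ := by ring

/-- ★ `normRow_of_le` — **THE ROW TRANSFERS ALONG A POINTWISE DOMINATION WITH A CONSTANT**: `‖G f‖ ≤ c·‖G′ f‖` (`c ≥ 0`) everywhere and the row for `G′` give the row for `G` (`B₀′ :=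
max c 1 · B′`).  Use: `G := 𝒢f`, `G′ := Σ_κ 𝒢f ∘ π_κ` (then `c = 1` by `𝒢f f = Σ_κ 𝒢f(π_κ f)`), or the fibre-norm∕component constant. [cite: Balaban1985Variational, (117) p.295 (shape only; bookkeeping)] -/
theorem normRow_of_le (G G' : ∀ (i : KIdx 2 ℓ hd3 hL 1 1) (U : (bgT3 i).Cfg), Xo i U → Yo i U) (c : ℝ) (hc : 0 ≤ c)
    (hle : ∀ (i : KIdx 2 ℓ hd3 hL 1 1) (U : (bgT3 i).Cfg) (f : Xo i U), ‖G i U f‖ ≤ c * ‖G' i U f‖)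
    (h : ∃ M₄ a₀ B₀' : ℝ, 0 < M₄ ∧ 0 < a₀ ∧ 0 < B₀' ∧
      ∀ (hℓ : 4 ≤ ℓ) (m : ℕ) (hm : 1 ≤ m) (n K a' R : ℕ) (hk1 : 1 ≤ K - n) (hsize : a' + 3 ≤ m + n) (hM8 : 8 ≤ (ℓ + 1) ^ a') (hR2 : 2 * (ℓ + 1) ^ 2 ≤ R),
        M₄ ≤ ((ℓ + 1 : ℕ) : ℝ) * (((ℓ + 1) ^ a' : ℕ) : ℝ) →
        ∀ (e : ℝ) (U₀ : GaugeField (PV 2 ℓ m K hd3 hL) 0 (Matrix.specialUnitaryGroup (Fin 2) ℂ)),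
          RegPr (⟨ℓ + 1, hL, m, hm⟩ : T3Family) n K e U₀ → e ≤ a₀ / (((ℓ + 1 : ℕ) : ℝ) * (((ℓ + 1) ^ a' : ℕ) : ℝ)) →
            ∀ f : Xo (memberIdx ℓ hL hℓ m hm n K a' R hk1 hsize hM8 hR2) (cfgV1OfT3 U₀),
              ‖G' (memberIdx ℓ hL hℓ m hm n K a' R hk1 hsize hM8 hR2) (cfgV1OfT3 U₀) f‖ ≤ B₀' * ‖f‖) :
    ∃ M₄ a₀ B₀' : ℝ, 0 < M₄ ∧ 0 < a₀ ∧ 0 < B₀' ∧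
      ∀ (hℓ : 4 ≤ ℓ) (m : ℕ) (hm : 1 ≤ m) (n K a' R : ℕ) (hk1 : 1 ≤ K - n) (hsize : a' + 3 ≤ m + n) (hM8 : 8 ≤ (ℓ + 1) ^ a') (hR2 : 2 * (ℓ + 1) ^ 2 ≤ R),
        M₄ ≤ ((ℓ + 1 : ℕ) : ℝ) * (((ℓ + 1) ^ a' : ℕ) : ℝ) →
        ∀ (e : ℝ) (U₀ : GaugeField (PV 2 ℓ m K hd3 hL) 0 (Matrix.specialUnitaryGroup (Fin 2) ℂ)),
          RegPr (⟨ℓ + 1, hL, m, hm⟩ : T3Family) n K e U₀ → e ≤ a₀ / (((ℓ + 1 : ℕ) : ℝ) * (((ℓ + 1) ^ a' : ℕ) : ℝ)) →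
            ∀ f : Xo (memberIdx ℓ hL hℓ m hm n K a' R hk1 hsize hM8 hR2) (cfgV1OfT3 U₀),
              ‖G (memberIdx ℓ hL hℓ m hm n K a' R hk1 hsize hM8 hR2) (cfgV1OfT3 U₀) f‖ ≤ B₀' * ‖f‖ := by
  obtain ⟨M₄, a₀, B, hM₄, ha₀, hB, h⟩ := h
  refine ⟨M₄, a₀, max c 1 * B, hM₄, ha₀, mul_pos (lt_max_of_lt_right one_pos) hB, ?_⟩
  intro hℓ m hm n K a' R hk1 hsize hM8 hR2 hM e U₀ hreg he f
  have h' := h hℓ m hm n K a' R hk1 hsize hM8 hR2 hM e U₀ hreg he f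
  calc ‖G _ _ f‖ ≤ c * ‖G' _ _ f‖ := hle _ _ f
    _ ≤ c * (B * ‖f‖) := mul_le_mul_of_nonneg_left h' hc
    _ ≤ max c 1 * (B * ‖f‖) := mul_le_mul_of_nonneg_right (le_max_left _ _) (mul_nonneg hB.le (norm_nonneg f))
    _ = max c 1 * B * ‖f‖ := by ring

/-- ★★ `normRow_sum` — **THE ROW IS CLOSED UNDER FINITE SUMS** over `Fin k` (induction with `normRow_zero`, `normRow_add`): per-direction rows for `Gop_κ` (κ < k) give the row for
`f ↦ Σ_κ Gop_κ f` — the assembly of a normed M₂(ℂ)-valued letter from its readings direction by direction through scalar sources (J2). [cite: Balaban1985Variational, (117) p.295 (shape only; bookkeeping)] -/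
theorem normRow_sum {k : ℕ} (G : Fin k → ∀ (i : KIdx 2 ℓ hd3 hL 1 1) (U : (bgT3 i).Cfg), Xo i U → Yo i U)
    (h : ∀ κ : Fin k, ∃ M₄ a₀ B₀' : ℝ, 0 < M₄ ∧ 0 < a₀ ∧ 0 < B₀' ∧
      ∀ (hℓ : 4 ≤ ℓ) (m : ℕ) (hm : 1 ≤ m) (n K a' R : ℕ) (hk1 : 1 ≤ K - n) (hsize : a' + 3 ≤ m + n) (hM8 : 8 ≤ (ℓ + 1) ^ a') (hR2 : 2 * (ℓ + 1) ^ 2 ≤ R),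
        M₄ ≤ ((ℓ + 1 : ℕ) : ℝ) * (((ℓ + 1) ^ a' : ℕ) : ℝ) →
        ∀ (e : ℝ) (U₀ : GaugeField (PV 2 ℓ m K hd3 hL) 0 (Matrix.specialUnitaryGroup (Fin 2) ℂ)),
          RegPr (⟨ℓ + 1, hL, m, hm⟩ : T3Family) n K e U₀ → e ≤ a₀ / (((ℓ + 1 : ℕ) : ℝ) * (((ℓ + 1) ^ a' : ℕ) : ℝ)) →
            ∀ f : Xo (memberIdx ℓ hL hℓ m hm n K a' R hk1 hsize hM8 hR2) (cfgV1OfT3 U₀),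
              ‖G κ (memberIdx ℓ hL hℓ m hm n K a' R hk1 hsize hM8 hR2) (cfgV1OfT3 U₀) f‖ ≤ B₀' * ‖f‖) :
    ∃ M₄ a₀ B₀' : ℝ, 0 < M₄ ∧ 0 < a₀ ∧ 0 < B₀' ∧
      ∀ (hℓ : 4 ≤ ℓ) (m : ℕ) (hm : 1 ≤ m) (n K a' R : ℕ) (hk1 : 1 ≤ K - n) (hsize : a' + 3 ≤ m + n) (hM8 : 8 ≤ (ℓ + 1) ^ a') (hR2 : 2 * (ℓ + 1) ^ 2 ≤ R),
        M₄ ≤ ((ℓ + 1 : ℕ) : ℝ) * (((ℓ + 1) ^ a' : ℕ) : ℝ) →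
        ∀ (e : ℝ) (U₀ : GaugeField (PV 2 ℓ m K hd3 hL) 0 (Matrix.specialUnitaryGroup (Fin 2) ℂ)),
          RegPr (⟨ℓ + 1, hL, m, hm⟩ : T3Family) n K e U₀ → e ≤ a₀ / (((ℓ + 1 : ℕ) : ℝ) * (((ℓ + 1) ^ a' : ℕ) : ℝ)) →
            ∀ f : Xo (memberIdx ℓ hL hℓ m hm n K a' R hk1 hsize hM8 hR2) (cfgV1OfT3 U₀),
              ‖(fun (i : KIdx 2 ℓ hd3 hL 1 1) (U : (bgT3 i).Cfg) (f : Xo i U) => ∑ κ : Fin k, G κ i U f) (memberIdx ℓ hL hℓ m hm n K a' R hk1 hsize hM8 hR2) (cfgV1OfT3 U₀) f‖ ≤ B₀' * ‖f‖ := by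
  induction k with
  | zero =>
    have e0 : (fun (i : KIdx 2 ℓ hd3 hL 1 1) (U : (bgT3 i).Cfg) (f : Xo i U) => ∑ κ : Fin 0, G κ i U f) =
        fun (i : KIdx 2 ℓ hd3 hL 1 1) (U : (bgT3 i).Cfg) (_ : Xo i U) => (0 : Yo i U) := by
      funext i U f
      rw [Finset.univ_eq_empty, Finset.sum_empty]
    rw [e0]
    exact normRow_zero
  | succ k ih =>
    have es : (fun (i : KIdx 2 ℓ hd3 hL 1 1) (U : (bgT3 i).Cfg) (f : Xo i U) => ∑ κ : Fin (k + 1), G κ i U f) =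
        fun (i : KIdx 2 ℓ hd3 hL 1 1) (U : (bgT3 i).Cfg) (f : Xo i U) => G 0 i U f + (fun i' U' f' => ∑ κ : Fin k, G κ.succ i' U' f') i U f := by
      funext i U f
      rw [Fin.sum_univ_succ]
    rw [es]
    exact normRow_add (G 0) (fun i U f => ∑ κ : Fin k, G κ.succ i U f) (h 0) (ih (fun κ => G κ.succ) (fun κ => h κ.succ))

end Summit.QuantumFields.YangMills.Theorems.Prop7SectET3NormRowAlgebra

end
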